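import Literature.Analysis.FluidPDE.StokesTorusProofs
import Literature.Analysis.FunctionSpaces.TorusCalculusProofs
import Literature.Analysis.FunctionSpaces.TorusVectorParseval
import Literature.Analysis.FunctionSpaces.TorusSobolevNormFacts
import Literature.Analysis.FunctionSpaces.TorusSobolevNormProofs
import HarnessLib

/-!
# The convective pairing of two `L²` fields against a Stokes mode, Fourier side

Analysis/FluidPDE support file (everything proved; no definitions, no named facts), sibling of
`StokesTorusProofs.lean`.  For `L²` vector fields `u, w` on the flat torus `T^d` and the real Stokes
mode `φ = stokesMode k a c = Re (e_k ζ)`, `ζ = (1 | -i) • complexify a`, the trilinear pairing of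
the Navier–Stokes nonlinearity `b(u, φ, w) = ∫ ⟪w, (u·∇)φ⟫` (Constantin–Foias 1988, Ch. 6,
(6.9)–(6.10)) is read off ONE Fourier coefficient of the integrable field
`x ↦ ⟪k, u(x)⟫ w(x)`:

* `Torus.convect_stokesMode_apply` — `(u·∇)φ (x) = ⟪k, u x⟫ Re (e_k(x) (2πi) ζ)`;
* `Torus.integral_inner_convect_stokesMode` —
  `∫ ⟪w, (u·∇)φ⟫ = Re ⟪ζ, (-2πi) • 𝓕(⟪k, u⟫ w)(k)⟫_ℂ`;
* the algebra of the coefficient `𝓕(⟪a, u⟫ w)(k)` in `u` and `w` (a.e.-congruence, additivity,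
  homogeneity, and the reality relation `k ↦ -k`), `Torus.mFourierCoeff_inner_smul_*`;
* `Torus.enorm_sq_mFourierCoeff_inner_smul_le` — the PRODUCT BOUND
  `‖𝓕(⟪a, u⟫ w)(k)‖² ≤ d ‖a‖² (∑_j ‖ŵ(k - j)‖ ‖û(j)‖)²` (`û = 𝓕(complexify ∘ u)`), from the
  polarised Parseval identity (Grafakos 2014, Prop. 3.2.7 (3)), the Fourier-side form of
  "coefficients of a product are the convolution of the coefficients" for two `L²` factors.

These are the inputs of the construction of the bounded bilinear form
`N(y, z) = A^{-3/4} (1 + A)^{1/2} P B((1+A)^{-1/2} y, (1+A)^{-1/2} z)` of the mild formulation of the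
Navier–Stokes equations on the energy space of `T³` (`StokesTorusBilinearForm.lean`).

## References

* P. Constantin, C. Foias, *Navier–Stokes Equations*, Univ. Chicago Press (1988), Ch. 6,
  (6.9)–(6.10). [ConstantinFoiasNSE1988]
* L. Grafakos, *Classical Fourier Analysis*, 3rd ed., GTM 249 (2014), Prop. 3.2.7 (3). [Grafakos2014]
-/

noncomputable section

open MeasureTheory Filter UnitAddTorus
open scoped InnerProductSpace RealInnerProductSpace ENNReal Topology ComplexConjugate

namespace Literature.Analysis.FluidPDE

namespace Torus

variable {d : Type*} [Fintype d] [DecidableEq d]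

/-! ### The convective derivative of a Stokes mode -/

/-- **The convective derivative of a Stokes mode along a field**:
`(u·∇) Re (e_k ζ) (x) = ⟪k, u(x)⟫ · Re (e_k(x) (2πi) ζ)` (`∂_j e_k = 2πi k_j e_k`,
`Torus.partialDeriv_realTrigPoly`; Constantin–Foias 1988, Ch. 4, (4.42)). [folklore] -/
theorem convect_stokesMode_apply (u : UnitAddTorus d → EuclideanSpace ℝ d) (k : d → ℤ)
    (a : EuclideanSpace ℝ d) (c : Bool) (x : UnitAddTorus d) :
    FunctionSpaces.Torus.convect u (stokesMode k a c) x =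
      ⟪FunctionSpaces.Torus.latticeVec k, u x⟫_ℝ •
        FunctionSpaces.Torus.realTrigPoly {k}
          (fun _ => (2 * Real.pi * Complex.I) •
            ((if c then (1 : ℂ) else -Complex.I) • FunctionSpaces.EuclideanSpace.complexify a)) x := by
  set ζ : EuclideanSpace ℂ d :=
    (if c then (1 : ℂ) else -Complex.I) • FunctionSpaces.EuclideanSpace.complexify a with hζ
  have hφ : FunctionSpaces.Torus.IsContDiff 1 ⇑(stokesMode k a c) :=
    (isSmooth_stokesMode k a c).isContDiff (by simp)
  unfold FunctionSpaces.Torus.convect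
  rw [FunctionSpaces.Torus.fderiv_apply_eq_sum_partialDeriv hφ, stokesMode_eq_realTrigPoly]
  simp_rw [FunctionSpaces.Torus.partialDeriv_realTrigPoly,
    FunctionSpaces.Torus.realTrigPoly_singleton_apply, ← hζ]
  -- move the real scalars inside `realPart` and compare the complex vectors
  have e1 : ∀ i : d, (u x) i • FunctionSpaces.EuclideanSpace.realPart
      (mFourier k x • ((2 * Real.pi * Complex.I * (k i : ℂ)) • ζ)) =
      FunctionSpaces.EuclideanSpace.realPart
        ((((u x) i : ℝ) : ℂ) • (mFourier k x • ((2 * Real.pi * Complex.I * (k i : ℂ)) • ζ))) := by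
    intro i
    rw [Complex.coe_smul, ContinuousLinearMap.map_smul]
  have e2 : ⟪FunctionSpaces.Torus.latticeVec k, u x⟫_ℝ • FunctionSpaces.EuclideanSpace.realPart
      (mFourier k x • ((2 * Real.pi * Complex.I) • ζ)) =
      FunctionSpaces.EuclideanSpace.realPart
        (((⟪FunctionSpaces.Torus.latticeVec k, u x⟫_ℝ : ℝ) : ℂ) •
          (mFourier k x • ((2 * Real.pi * Complex.I) • ζ))) := by
    rw [Complex.coe_smul, ContinuousLinearMap.map_smul]
  simp_rw [e1]
  rw [e2, ← map_sum]
  congr 1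
  simp_rw [smul_smul]
  rw [← Finset.sum_smul]
  congr 1
  rw [← sum_intCast_mul_eq_inner_latticeVec]
  push_cast
  rw [Finset.sum_mul]
  exact Finset.sum_congr rfl fun i _ => by ring

/-- The convective pairing against a Stokes mode, pointwise:
`⟪w x, (u·∇)φ (x)⟫ = ⟪⟪k, u x⟫ w x, Re (e_k(x) (2πi) ζ)⟫`. [folklore] -/
theorem inner_convect_stokesMode_apply (u w : UnitAddTorus d → EuclideanSpace ℝ d) (k : d → ℤ)
    (a : EuclideanSpace ℝ d) (c : Bool) (x : UnitAddTorus d) :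
    ⟪w x, FunctionSpaces.Torus.convect u (stokesMode k a c) x⟫_ℝ =
      ⟪⟪FunctionSpaces.Torus.latticeVec k, u x⟫_ℝ • w x,
        FunctionSpaces.Torus.realTrigPoly {k}
          (fun _ => (2 * Real.pi * Complex.I) •
            ((if c then (1 : ℂ) else -Complex.I) • FunctionSpaces.EuclideanSpace.complexify a)) x⟫_ℝ := by
  rw [convect_stokesMode_apply, real_inner_smul_right, real_inner_smul_left]

/-! ### The field `x ↦ ⟪a, u x⟫ w x` of two `L²` fields -/

omit [DecidableEq d] in
/-- For `L²` fields `u, w` and `a ∈ ℝ^d`, the field `x ↦ ⟪a, u x⟫ w x` is integrable (Hölder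
`L² · L² ⊂ L¹`). [folklore] -/
theorem integrable_inner_smul {u w : UnitAddTorus d → EuclideanSpace ℝ d} (hu : MemLp u 2 volume)
    (hw : MemLp w 2 volume) (a : EuclideanSpace ℝ d) :
    Integrable (fun x => ⟪a, u x⟫_ℝ • w x) volume := by
  have h1 : MemLp (fun x => ⟪a, u x⟫_ℝ) 2 volume := (innerSL ℝ a).comp_memLp' hu
  exact (MemLp.smul (r := 1) hw h1).integrable le_rfl

omit [DecidableEq d] in
/-- The Fourier coefficients of `⟪a, u⟫ w` only see the a.e.-classes of `u` and `w`. [folklore] -/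
theorem mFourierCoeff_inner_smul_congr_ae {u₁ u₂ w₁ w₂ : UnitAddTorus d → EuclideanSpace ℝ d}
    (hu : u₁ =ᵐ[volume] u₂) (hw : w₁ =ᵐ[volume] w₂) (a : EuclideanSpace ℝ d) (k : d → ℤ) :
    mFourierCoeff (FunctionSpaces.EuclideanSpace.complexify ∘ fun x => ⟪a, u₁ x⟫_ℝ • w₁ x) k =
      mFourierCoeff (FunctionSpaces.EuclideanSpace.complexify ∘ fun x => ⟪a, u₂ x⟫_ℝ • w₂ x) k := by
  refine FunctionSpaces.Torus.mFourierCoeff_congr_ae ?_ k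
  filter_upwards [hu, hw] with x hx hy
  simp only [Function.comp_apply, hx, hy]

omit [DecidableEq d] in
/-- Additivity of `𝓕(⟪a, u⟫ w)(k)` in `u`. [folklore] -/
theorem mFourierCoeff_inner_smul_add_left {u₁ u₂ w : UnitAddTorus d → EuclideanSpace ℝ d}
    (hu₁ : MemLp u₁ 2 volume) (hu₂ : MemLp u₂ 2 volume) (hw : MemLp w 2 volume)
    (a : EuclideanSpace ℝ d) (k : d → ℤ) :
    mFourierCoeff (FunctionSpaces.EuclideanSpace.complexify ∘ fun x => ⟪a, (u₁ + u₂) x⟫_ℝ • w x) k =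
      mFourierCoeff (FunctionSpaces.EuclideanSpace.complexify ∘ fun x => ⟪a, u₁ x⟫_ℝ • w x) k +
        mFourierCoeff (FunctionSpaces.EuclideanSpace.complexify ∘ fun x => ⟪a, u₂ x⟫_ℝ • w x) k := by
  have hfun : (FunctionSpaces.EuclideanSpace.complexify ∘ fun x => ⟪a, (u₁ + u₂) x⟫_ℝ • w x) =
      (FunctionSpaces.EuclideanSpace.complexify ∘ fun x => ⟪a, u₁ x⟫_ℝ • w x) +
        (FunctionSpaces.EuclideanSpace.complexify ∘ fun x => ⟪a, u₂ x⟫_ℝ • w x) := by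
    funext x
    simp only [Function.comp_apply, Pi.add_apply, inner_add_right, add_smul, map_add]
  rw [hfun, FunctionSpaces.Torus.mFourierCoeff_add
    (FunctionSpaces.Torus.integrable_complexify_comp (integrable_inner_smul hu₁ hw a))
    (FunctionSpaces.Torus.integrable_complexify_comp (integrable_inner_smul hu₂ hw a))]

omit [DecidableEq d] in
/-- Additivity of `𝓕(⟪a, u⟫ w)(k)` in `w`. [folklore] -/
theorem mFourierCoeff_inner_smul_add_right {u w₁ w₂ : UnitAddTorus d → EuclideanSpace ℝ d}
    (hu : MemLp u 2 volume) (hw₁ : MemLp w₁ 2 volume) (hw₂ : MemLp w₂ 2 volume)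
    (a : EuclideanSpace ℝ d) (k : d → ℤ) :
    mFourierCoeff (FunctionSpaces.EuclideanSpace.complexify ∘ fun x => ⟪a, u x⟫_ℝ • (w₁ + w₂) x) k =
      mFourierCoeff (FunctionSpaces.EuclideanSpace.complexify ∘ fun x => ⟪a, u x⟫_ℝ • w₁ x) k +
        mFourierCoeff (FunctionSpaces.EuclideanSpace.complexify ∘ fun x => ⟪a, u x⟫_ℝ • w₂ x) k := by
  have hfun : (FunctionSpaces.EuclideanSpace.complexify ∘ fun x => ⟪a, u x⟫_ℝ • (w₁ + w₂) x) =
      (FunctionSpaces.EuclideanSpace.complexify ∘ fun x => ⟪a, u x⟫_ℝ • w₁ x) +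
        (FunctionSpaces.EuclideanSpace.complexify ∘ fun x => ⟪a, u x⟫_ℝ • w₂ x) := by
    funext x
    simp only [Function.comp_apply, Pi.add_apply, smul_add, map_add]
  rw [hfun, FunctionSpaces.Torus.mFourierCoeff_add
    (FunctionSpaces.Torus.integrable_complexify_comp (integrable_inner_smul hu hw₁ a))
    (FunctionSpaces.Torus.integrable_complexify_comp (integrable_inner_smul hu hw₂ a))]

omit [DecidableEq d] in
/-- Homogeneity of `𝓕(⟪a, u⟫ w)(k)` in `u`. [folklore] -/
theorem mFourierCoeff_inner_smul_smul_left (u w : UnitAddTorus d → EuclideanSpace ℝ d) (r : ℝ)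
    (a : EuclideanSpace ℝ d) (k : d → ℤ) :
    mFourierCoeff (FunctionSpaces.EuclideanSpace.complexify ∘ fun x => ⟪a, (r • u) x⟫_ℝ • w x) k =
      (r : ℂ) • mFourierCoeff (FunctionSpaces.EuclideanSpace.complexify ∘ fun x => ⟪a, u x⟫_ℝ • w x) k := by
  have hfun : (FunctionSpaces.EuclideanSpace.complexify ∘ fun x => ⟪a, (r • u) x⟫_ℝ • w x) =
      (r : ℂ) • (FunctionSpaces.EuclideanSpace.complexify ∘ fun x => ⟪a, u x⟫_ℝ • w x) := by
    funext x
    simp only [Function.comp_apply, Pi.smul_apply, real_inner_smul_right, mul_smul,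
      LinearIsometry.map_smul]
    rw [Complex.coe_smul]
  rw [hfun, FunctionSpaces.Torus.mFourierCoeff_const_smul]

omit [DecidableEq d] in
/-- Homogeneity of `𝓕(⟪a, u⟫ w)(k)` in `w`. [folklore] -/
theorem mFourierCoeff_inner_smul_smul_right (u w : UnitAddTorus d → EuclideanSpace ℝ d) (r : ℝ)
    (a : EuclideanSpace ℝ d) (k : d → ℤ) :
    mFourierCoeff (FunctionSpaces.EuclideanSpace.complexify ∘ fun x => ⟪a, u x⟫_ℝ • (r • w) x) k =
      (r : ℂ) • mFourierCoeff (FunctionSpaces.EuclideanSpace.complexify ∘ fun x => ⟪a, u x⟫_ℝ • w x) k := by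
  have hfun : (FunctionSpaces.EuclideanSpace.complexify ∘ fun x => ⟪a, u x⟫_ℝ • (r • w) x) =
      (r : ℂ) • (FunctionSpaces.EuclideanSpace.complexify ∘ fun x => ⟪a, u x⟫_ℝ • w x) := by
    funext x
    simp only [Function.comp_apply, Pi.smul_apply, smul_comm _ r, LinearIsometry.map_smul]
    rw [Complex.coe_smul]
  rw [hfun, FunctionSpaces.Torus.mFourierCoeff_const_smul]

/-- **Reality relation** of the coefficients `k ↦ 𝓕(⟪k, u⟫ w)(k)`:
`𝓕(⟪-k, u⟫ w)(-k) = - conj 𝓕(⟪k, u⟫ w)(k)` (the field `⟪k, u⟫ w` is real, Grafakos 2014,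
Prop. 3.2.6 (4)). [folklore] -/
theorem mFourierCoeff_inner_smul_neg {u w : UnitAddTorus d → EuclideanSpace ℝ d}
    (hu : MemLp u 2 volume) (hw : MemLp w 2 volume) (k : d → ℤ) :
    mFourierCoeff (FunctionSpaces.EuclideanSpace.complexify ∘
        fun x => ⟪FunctionSpaces.Torus.latticeVec (-k), u x⟫_ℝ • w x) (-k) =
      -FunctionSpaces.EuclideanSpace.conjVec
        (mFourierCoeff (FunctionSpaces.EuclideanSpace.complexify ∘
          fun x => ⟪FunctionSpaces.Torus.latticeVec k, u x⟫_ℝ • w x) k) := by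
  have hneg : FunctionSpaces.Torus.latticeVec (-k) = -FunctionSpaces.Torus.latticeVec k := by
    ext i
    simp [FunctionSpaces.Torus.latticeVec_apply]
  have hfun : (FunctionSpaces.EuclideanSpace.complexify ∘
      fun x => ⟪FunctionSpaces.Torus.latticeVec (-k), u x⟫_ℝ • w x) =
      -(FunctionSpaces.EuclideanSpace.complexify ∘
        fun x => ⟪FunctionSpaces.Torus.latticeVec k, u x⟫_ℝ • w x) := by
    funext x
    simp only [Function.comp_apply, Pi.neg_apply, hneg, inner_neg_left, neg_smul, map_neg]
  rw [hfun, FunctionSpaces.Torus.mFourierCoeff_neg]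
  congr 1
  exact (FunctionSpaces.Torus.isConjSymm_mFourierCoeff (integrable_inner_smul hu hw _)) k

/-! ### The convective pairing as a Fourier coefficient -/

omit [DecidableEq d] in
/-- `Re ⟪H, s ζ⟫_ℂ = Re ⟪ζ, s̄ H⟫_ℂ`. [folklore] -/
theorem re_inner_smul_right_eq_re_inner_conj_smul (H ζ : EuclideanSpace ℂ d) (s : ℂ) :
    (⟪H, s • ζ⟫_ℂ).re = (⟪ζ, (starRingEnd ℂ s) • H⟫_ℂ).re := by
  rw [inner_smul_right, inner_smul_right, ← inner_conj_symm ζ H, ← map_mul, Complex.conj_re]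

/-- **The convective pairing of two `L²` fields against a Stokes mode is a Fourier coefficient**:
for `u, w ∈ L²(T^d; ℝ^d)` and `φ = stokesMode k a c = Re (e_k ζ)`,
`∫ ⟪w, (u·∇)φ⟫ = Re ⟪ζ, (-2πi) • 𝓕(⟪k, u⟫ w)(k)⟫_ℂ` (`Torus.integral_inner_realTrigPoly_singleton`
applied to the integrable field `⟪k, u⟫ w`; Constantin–Foias 1988, Ch. 6, (6.9)–(6.10): the
trilinear form `b(u, v, w) = ∫ uⱼ (∂ⱼ vᵢ) wᵢ`). [cite: ConstantinFoiasNSE1988, Ch. 6 (6.9)–(6.10)] -/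
theorem integral_inner_convect_stokesMode {u w : UnitAddTorus d → EuclideanSpace ℝ d}
    (hu : MemLp u 2 volume) (hw : MemLp w 2 volume) (k : d → ℤ) (a : EuclideanSpace ℝ d) (c : Bool) :
    ∫ x, ⟪w x, FunctionSpaces.Torus.convect u (stokesMode k a c) x⟫_ℝ =
      (⟪(if c then (1 : ℂ) else -Complex.I) • FunctionSpaces.EuclideanSpace.complexify a,
        (-(2 * Real.pi * Complex.I)) •
          mFourierCoeff (FunctionSpaces.EuclideanSpace.complexify ∘
            fun x => ⟪FunctionSpaces.Torus.latticeVec k, u x⟫_ℝ • w x) k⟫_ℂ).re := by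
  simp_rw [inner_convect_stokesMode_apply]
  rw [FunctionSpaces.Torus.integral_inner_realTrigPoly_singleton (integrable_inner_smul hu hw _) k,
    re_inner_smul_right_eq_re_inner_conj_smul]
  congr 3
  simp [Complex.conj_ofReal, map_ofNat]

/-! ### The product bound -/

omit [DecidableEq d] in
/-- Fourier coefficients commute with continuous linear maps:
`𝓕(L ∘ f)(k) = L (𝓕 f (k))` for integrable `f`. [folklore] -/
theorem mFourierCoeff_clm_comp {F G : Type*} [NormedAddCommGroup F] [NormedSpace ℂ F]
    [NormedAddCommGroup G] [NormedSpace ℂ G] [CompleteSpace F] [CompleteSpace G]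
    (L : F →L[ℂ] G) {f : UnitAddTorus d → F} (hf : Integrable f volume) (k : d → ℤ) :
    mFourierCoeff (L ∘ f) k = L (mFourierCoeff f k) := by
  rw [FunctionSpaces.Torus.mFourierCoeff_eq_integral_volume,
    FunctionSpaces.Torus.mFourierCoeff_eq_integral_volume,
    ← ContinuousLinearMap.integral_comp_comm L (FunctionSpaces.Torus.integrable_mFourier_smul' hf k)]
  refine integral_congr_ae (ae_of_all _ fun x => ?_)
  simp only [Function.comp_apply, map_smul]

omit [DecidableEq d] in
/-- The Fourier coefficients of the scalar function `⟪a, u⟫`: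
`𝓕(⟪a, u⟫)(j) = ⟪complexify a, û(j)⟫_ℂ`. [folklore] -/
theorem mFourierCoeff_ofReal_inner {u : UnitAddTorus d → EuclideanSpace ℝ d} (hu : Integrable u volume)
    (a : EuclideanSpace ℝ d) (j : d → ℤ) :
    mFourierCoeff (fun x => ((⟪a, u x⟫_ℝ : ℝ) : ℂ)) j =
      ⟪FunctionSpaces.EuclideanSpace.complexify a,
        mFourierCoeff (FunctionSpaces.EuclideanSpace.complexify ∘ u) j⟫_ℂ := by
  have hfun : (fun x => ((⟪a, u x⟫_ℝ : ℝ) : ℂ)) =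
      (innerSL ℂ (FunctionSpaces.EuclideanSpace.complexify a)) ∘
        (FunctionSpaces.EuclideanSpace.complexify ∘ u) := by
    funext x
    simp only [Function.comp_apply, innerSL_apply_apply,
      FunctionSpaces.EuclideanSpace.inner_complexify]
  rw [hfun, mFourierCoeff_clm_comp _ (FunctionSpaces.Torus.integrable_complexify_comp hu),
    innerSL_apply_apply]

omit [DecidableEq d] in
/-- **Coefficients of the product `⟪a, u⟫ wₗ` of two `L²` factors are dominated by the
convolution of the coefficient norms**: `‖𝓕(⟪a, u⟫ wₗ)(k)‖ ≤ ‖a‖ ∑_j ‖ŵ(k - j)‖ ‖û(j)‖`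
(polarised Parseval `∑_j conj(ĝ(j)) ĥ(j) = ∫ conj(g) h` with `g = e_k wₗ`, `h = ⟪a, u⟫`,
Grafakos 2014, Prop. 3.2.7 (3); `|𝓕(⟪a, u⟫)(j)| ≤ ‖a‖ ‖û(j)‖` and `‖ŵ(-m)‖ = ‖ŵ(m)‖`).
[cite: Grafakos2014, Prop. 3.2.7 (3)] -/
theorem enorm_mFourierCoeff_inner_mul_apply_le {u w : UnitAddTorus d → EuclideanSpace ℝ d}
    (hu : MemLp u 2 volume) (hw : MemLp w 2 volume) (a : EuclideanSpace ℝ d) (k : d → ℤ) (l : d) :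
    ‖mFourierCoeff (fun x => ((⟪a, u x⟫_ℝ * w x l : ℝ) : ℂ)) k‖ₑ ≤
      ENNReal.ofReal ‖a‖ *
        ∑' j, ‖mFourierCoeff (FunctionSpaces.EuclideanSpace.complexify ∘ w) (k - j)‖ₑ *
          ‖mFourierCoeff (FunctionSpaces.EuclideanSpace.complexify ∘ u) j‖ₑ := by
  have hui : Integrable u volume := hu.integrable one_le_two
  have hwi : Integrable w volume := hw.integrable one_le_two
  set cw : (d → ℤ) → EuclideanSpace ℂ d := fun m =>
    mFourierCoeff (FunctionSpaces.EuclideanSpace.complexify ∘ w) m with hcw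
  set cu : (d → ℤ) → EuclideanSpace ℂ d := fun m =>
    mFourierCoeff (FunctionSpaces.EuclideanSpace.complexify ∘ u) m with hcu
  -- the two scalar `L²` functions
  set g : UnitAddTorus d → ℂ := fun x => mFourier k x * (w x l : ℂ) with hg
  set h : UnitAddTorus d → ℂ := fun x => ((⟪a, u x⟫_ℝ : ℝ) : ℂ) with hh
  have hwl : MemLp (fun x => (w x l : ℂ)) 2 volume := FunctionSpaces.Torus.memLp_ofReal_apply hw l
  have hgm : MemLp g 2 volume := by
    refine MemLp.of_le hwl ((mFourier k).continuous.aestronglyMeasurable.mul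
      hwl.aestronglyMeasurable) (ae_of_all _ fun x => ?_)
    simp only [hg, norm_mul]
    calc ‖mFourier k x‖ * ‖(w x l : ℂ)‖ ≤ 1 * ‖(w x l : ℂ)‖ :=
          mul_le_mul_of_nonneg_right (((mFourier k).norm_coe_le_norm x).trans_eq mFourier_norm)
            (norm_nonneg _)
      _ = ‖(w x l : ℂ)‖ := one_mul _
  have hhm : MemLp h 2 volume := by
    have h1 : MemLp (fun x => ⟪a, u x⟫_ℝ) 2 volume := (innerSL ℝ a).comp_memLp' hu
    exact Complex.ofRealCLM.comp_memLp' h1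
  -- polarised Parseval
  have H := FunctionSpaces.Torus.hasSum_conj_mul_mFourierCoeff hgm hhm
  -- (i) the integral is `𝓕(⟪a, u⟫ wₗ)(k)`
  have hval : ∫ x, conj (g x) * h x = mFourierCoeff (fun x => ((⟪a, u x⟫_ℝ * w x l : ℝ) : ℂ)) k := by
    rw [FunctionSpaces.Torus.mFourierCoeff_eq_integral_volume]
    refine integral_congr_ae (ae_of_all _ fun x => ?_)
    simp only [hg, hh, map_mul, Complex.conj_ofReal, ← mFourier_neg, smul_eq_mul, Complex.ofReal_mul]
    ring
  -- (ii) coefficients of `g`: `ĝ(j) = ŵₗ(j - k)`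
  have hgc : ∀ j, mFourierCoeff g j = mFourierCoeff (fun x => (w x l : ℂ)) (j - k) := by
    intro j
    rw [FunctionSpaces.Torus.mFourierCoeff_eq_integral_volume,
      FunctionSpaces.Torus.mFourierCoeff_eq_integral_volume]
    refine integral_congr_ae (ae_of_all _ fun x => ?_)
    simp only [hg, smul_eq_mul]
    rw [← mul_assoc, FunctionSpaces.Torus.mFourier_neg_mul, show k - j = -(j - k) by abel]
  -- (iii) scalar coefficients against vector coefficients
  have hcoordw : ∀ m : d → ℤ, ‖mFourierCoeff (fun x => (w x l : ℂ)) m‖ ≤ ‖cw m‖ := fun m => by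
    rw [hcw, ← FunctionSpaces.Torus.mFourierCoeff_complexify_apply hwi m l]
    exact PiLp.norm_apply_le _ l
  have hsymm : ∀ m, ‖cw (-m)‖ = ‖cw m‖ := fun m => by
    have := FunctionSpaces.Torus.isConjSymm_mFourierCoeff hwi m
    rw [hcw]
    dsimp only at this ⊢
    rw [this, FunctionSpaces.EuclideanSpace.norm_conjVec]
  have hhc : ∀ j, ‖mFourierCoeff h j‖ ≤ ‖a‖ * ‖cu j‖ := fun j => by
    rw [hh, mFourierCoeff_ofReal_inner hui a j]
    exact (norm_inner_le_norm _ _).trans_eq (by rw [FunctionSpaces.EuclideanSpace.norm_complexify])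
  -- assemble
  rw [← hval, ← H.tsum_eq]
  refine enorm_tsum_le_tsum_enorm.trans ?_
  rw [← ENNReal.tsum_mul_left]
  refine ENNReal.tsum_le_tsum fun j => ?_
  rw [enorm_mul, ← ofReal_norm, ← ofReal_norm, ← ofReal_norm (cw (k - j)), ← ofReal_norm (cu j),
    RCLike.norm_conj, ← ENNReal.ofReal_mul (norm_nonneg _), ← ENNReal.ofReal_mul (norm_nonneg _),
    ← ENNReal.ofReal_mul (norm_nonneg _)]
  refine ENNReal.ofReal_le_ofReal ?_
  have h1 : ‖mFourierCoeff g j‖ ≤ ‖cw (k - j)‖ := by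
    rw [hgc]
    calc ‖mFourierCoeff (fun x => (w x l : ℂ)) (j - k)‖ ≤ ‖cw (j - k)‖ := hcoordw _
      _ = ‖cw (k - j)‖ := by rw [← hsymm, neg_sub]
  calc ‖mFourierCoeff g j‖ * ‖mFourierCoeff h j‖ ≤ ‖cw (k - j)‖ * (‖a‖ * ‖cu j‖) :=
        mul_le_mul h1 (hhc j) (norm_nonneg _) (norm_nonneg _)
    _ = ‖a‖ * (‖cw (k - j)‖ * ‖cu j‖) := by ring

omit [DecidableEq d] in
/-- `‖x‖ₑ² = ∑ₗ ‖xₗ‖ₑ²` in `ℂ^d`. [folklore] -/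
theorem enorm_sq_eq_sum_enorm_sq (x : EuclideanSpace ℂ d) : ‖x‖ₑ ^ 2 = ∑ l, ‖x l‖ₑ ^ 2 := by
  rw [← ofReal_norm, ← ENNReal.ofReal_pow (norm_nonneg _), EuclideanSpace.norm_sq_eq,
    ENNReal.ofReal_sum_of_nonneg fun l _ => sq_nonneg _]
  refine Finset.sum_congr rfl fun l _ => ?_
  rw [← ofReal_norm, ENNReal.ofReal_pow (norm_nonneg _)]

omit [DecidableEq d] in
/-- **The product bound for `⟪a, u⟫ w`**: for `L²` fields `u, w`,
`‖𝓕(⟪a, u⟫ w)(k)‖² ≤ d ‖a‖² (∑_j ‖ŵ(k - j)‖ ‖û(j)‖)²` (`Torus.enorm_mFourierCoeff_inner_mul_apply_le`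
componentwise). [cite: Grafakos2014, Prop. 3.2.7 (3)] -/
theorem enorm_sq_mFourierCoeff_inner_smul_le {u w : UnitAddTorus d → EuclideanSpace ℝ d}
    (hu : MemLp u 2 volume) (hw : MemLp w 2 volume) (a : EuclideanSpace ℝ d) (k : d → ℤ) :
    ‖mFourierCoeff (FunctionSpaces.EuclideanSpace.complexify ∘ fun x => ⟪a, u x⟫_ℝ • w x) k‖ₑ ^ 2 ≤
      (Fintype.card d : ℝ≥0∞) * (ENNReal.ofReal ‖a‖ *
        ∑' j, ‖mFourierCoeff (FunctionSpaces.EuclideanSpace.complexify ∘ w) (k - j)‖ₑ *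
          ‖mFourierCoeff (FunctionSpaces.EuclideanSpace.complexify ∘ u) j‖ₑ) ^ 2 := by
  have hP := integrable_inner_smul hu hw a
  rw [enorm_sq_eq_sum_enorm_sq]
  calc ∑ l, ‖(mFourierCoeff (FunctionSpaces.EuclideanSpace.complexify ∘ fun x => ⟪a, u x⟫_ℝ • w x) k) l‖ₑ ^ 2
      ≤ ∑ _l : d, (ENNReal.ofReal ‖a‖ *
          ∑' j, ‖mFourierCoeff (FunctionSpaces.EuclideanSpace.complexify ∘ w) (k - j)‖ₑ *
            ‖mFourierCoeff (FunctionSpaces.EuclideanSpace.complexify ∘ u) j‖ₑ) ^ 2 := by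
        refine Finset.sum_le_sum fun l _ => pow_le_pow_left' ?_ 2
        rw [FunctionSpaces.Torus.mFourierCoeff_complexify_apply hP k l]
        have e : (fun x => (((fun x => ⟪a, u x⟫_ℝ • w x) x) l : ℂ)) =
            fun x => ((⟪a, u x⟫_ℝ * w x l : ℝ) : ℂ) := by
          funext x
          simp only [PiLp.smul_apply, smul_eq_mul]
        rw [e]
        exact enorm_mFourierCoeff_inner_mul_apply_le hu hw a k l
    _ = (Fintype.card d : ℝ≥0∞) * _ := by
        rw [Finset.sum_const, Finset.card_univ, nsmul_eq_mul]

end Torus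

end Literature.Analysis.FluidPDE

end
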